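import Literature.CategoryTheory.Preadditive.KrullSchmidtSemiperfect
import Literature.Algebra.Module.KrullSchmidtPowerCancellation
import HarnessLib

/-!
# Multiplicities of indecomposable summands and power cancellation for objects with semiperfect endomorphism ring
# (Krause, *Krull–Schmidt categories* Thm. 4.2, Cor. 4.3, Cor. 4.4; Lam, *First Course* (19.21)–(19.23), (20.13))

Family `hodge`, lane `lit-hodgefound` (foundations library; seat `lit-hodgefound-p39`, generation 37, row g37-#6); topic
`CategoryTheory/Preadditive`, namespace `Literature.CategoryTheory.KrullSchmidt` — categorical counterpart of g36-#8
`Literature/Algebra/Module/KrullSchmidtPowerCancellation` (modules), sequel of g37-#2 `KrullSchmidtSemiperfect`.  In a Krull–Schmidt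
situation (idempotent-complete preadditive category with finite biproducts, `End X` semiperfect) the isomorphism type of `X` is the
MULTISET of isomorphism types of its indecomposable summands; this file proves the two consequences used in practice: multiplicities are
well defined and determine `X`, and POWERS CANCEL — `X^{⊕t} ≅ Y^{⊕t}`, `t ≥ 1`, forces `X ≅ Y`.

Sources, verbatim.  Krause [Krause2015KS]: **Theorem 4.2.** «Let `X` be an object of an additive category and suppose there are two
decompositions `X₁ ⊕ … ⊕ X_r = X = Y₁ ⊕ … ⊕ Y_s` into objects with local endomorphism rings. Then `r = s` and there exists a permutation `π`
such that `Xᵢ ≅ Y_{π(i)}` for `1 ≤ i ≤ r`.» (proof: «the assertion now follows from the uniqueness of the decomposition of a semi-simple module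
into simple modules (which is easily proved by induction on the number of summands)»); **Corollary 4.3.** «… `n = s + t` and
`X″ ≅ X₁ ⊕ … ⊕ X_t` after some reindexing»; **Corollary 4.4.**  Lam [Lam2001FirstCourse]: **(19.21)** «`r = s`, and, after a reindexing,
we have `Mᵢ ≅ Nᵢ`»; **(20.13)** (cancellation consequences of stable range one: «(2) … `Rⁿ ≅ Rᵐ` … implies that `n = m`»).

## What is formalised (`C` preadditive with finite biproducts; index types in `Type`)

* §1 multiplicities: for two finite biproduct decompositions with local endomorphism rings (or into indecomposables, `End X` semiperfect)
  the number of summands isomorphic to a given `V` agrees (`natCard_nonempty_iso_eq_of_iso_biproduct[_of_indecomposable]`), and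
  **two objects with semiperfect endomorphism rings are isomorphic iff their indecomposable decompositions have the same multiplicities**
  (`nonempty_iso_iff_forall_natCard_eq`).
* §2 flattening powers: `X ≅ ⨁ⱼ Xⱼ ⟹ ⨁_{a ∈ α} X ≅ ⨁_{(a,j)} Xⱼ` (Mathlib `biproductBiproductIso`).
* §3 **POWER CANCELLATION: `⨁_{a ∈ α} X ≅ ⨁_{a ∈ α} Y` with `α` finite non-empty and `End X`, `End Y` semiperfect ⟹ `X ≅ Y`**
  (`nonempty_iso_of_biproduct_const_iso`; `Fin t` form with `t ≠ 0`; artinian ∕ finite-dimensional corollaries) — Krause 4.2 on the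
  flattened decompositions and the class-count lemmas g36-#8 `natCard_subtype_eq_of_prod_equiv`, `exists_equiv_forall_rel`.

Theorems only, 0 `sorry`, no definition, no named fact (net debt 0, D-0026), no instance, no notation.  NOT here: the binary form
`X ⊞ X ≅ Y ⊞ Y` (needs the `biprod`∕`biproduct (pairFunction)` dictionary) and Krause Cor. 4.3 in its reindexing form.

## Mathlib / Literature search

Mathlib: `biproduct.mapIso`, `biproduct.whiskerEquiv`, `biproductBiproductIso` (iterated biproduct ≅ biproduct over a sigma type),
`Equiv.sigmaEquivProd`, `Nat.card`, `Equiv.subtypeEquiv`; no multiplicity ∕ cancellation statements for biproducts.  Literature: g36-#8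
`Literature.Algebra.Module.KrullSchmidt.natCard_subtype_eq_of_prod_equiv ∕ natCard_subtype_eq_of_equiv ∕ exists_equiv_forall_rel` (pure
combinatorics, reused verbatim); g36-#15 `exists_equiv_iso_of_iso_biproduct`; g37-#2 `exists_equiv_iso_of_iso_biproduct_of_indecomposable`,
`exists_iso_biproduct_indecomposable_of_isSemiperfectRing`, `isLocalRing_end_of_iso_biproduct_of_indecomposable`.

## References

* H. Krause, *Krull–Schmidt categories and projective covers*, Expo. Math. 33 (2015), 535–549: Thm. 4.2, Cor. 4.3, Cor. 4.4. [Krause2015KS]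
* T. Y. Lam, *A First Course in Noncommutative Rings*, 2nd ed., GTM 131 (2001): §19 (19.21)–(19.23), §20 Thm. (20.13). [Lam2001FirstCourse]
-/

open CategoryTheory CategoryTheory.Limits

namespace Literature.CategoryTheory.KrullSchmidt

open Literature.RingTheory.Idempotents (IsSemiperfectRing)
open Literature.Algebra.Module.KrullSchmidt (natCard_subtype_eq_of_prod_equiv natCard_subtype_eq_of_equiv exists_equiv_forall_rel)

universe v u

variable {C : Type u} [Category.{v} C] [Preadditive C] [HasFiniteBiproducts C]

/-! ## §1 Multiplicities of isomorphism types -/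

section Multiplicity

omit [Preadditive C] [HasFiniteBiproducts C] in
/-- A summand-wise matching `Xⱼ ≅ Y_{σ j}` preserves the number of summands isomorphic to any `V`. [cite: Krause2015KS, Thm. 4.2]
[cite: Lam2001FirstCourse, §19 Thm. (19.21)] -/
theorem natCard_nonempty_iso_eq_of_equiv {ι κ : Type*} {Xs : ι → C} {Ys : κ → C} (σ : ι ≃ κ) (hσ : ∀ j, Nonempty (Xs j ≅ Ys (σ j)))
    (V : C) : Nat.card {j // Nonempty (Xs j ≅ V)} = Nat.card {k // Nonempty (Ys k ≅ V)} :=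
  natCard_subtype_eq_of_equiv σ fun j => by
    obtain ⟨e⟩ := hσ j
    exact ⟨fun ⟨f⟩ => ⟨e.symm ≪≫ f⟩, fun ⟨f⟩ => ⟨e ≪≫ f⟩⟩

/-- **Multiplicities are well defined (local endomorphism rings)**: for `X ≅ ⨁ⱼ Xⱼ ≅ ⨁ₖ Yₖ` with all `End(Xⱼ)`, `End(Yₖ)` local, the number
of `Xⱼ ≅ V` equals the number of `Yₖ ≅ V`, for every `V`. [cite: Krause2015KS, Thm. 4.2] [cite: Lam2001FirstCourse, §19 Thm. (19.21)] -/
theorem natCard_nonempty_iso_eq_of_iso_biproduct {X : C} {ι κ : Type} [Fintype ι] [Fintype κ] [DecidableEq ι] [DecidableEq κ]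
    {Xs : ι → C} {Ys : κ → C} (i₁ : X ≅ ⨁ Xs) (i₂ : X ≅ ⨁ Ys) (h₁ : ∀ j, IsLocalRing (End (Xs j)))
    (h₂ : ∀ k, IsLocalRing (End (Ys k))) (V : C) : Nat.card {j // Nonempty (Xs j ≅ V)} = Nat.card {k // Nonempty (Ys k ≅ V)} := by
  obtain ⟨σ, hσ⟩ := exists_equiv_iso_of_iso_biproduct i₁ i₂ h₁ h₂
  exact natCard_nonempty_iso_eq_of_equiv σ hσ V

/-- **Multiplicities are well defined (semiperfect `End X`, decompositions into indecomposables).** [cite: Krause2015KS, Thm. 4.2, Cor. 4.4]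
[cite: Lam2001FirstCourse, §19 Cor. (19.22)] -/
theorem natCard_nonempty_iso_eq_of_iso_biproduct_of_indecomposable [HasBinaryBiproducts C] [IsIdempotentComplete C] {X : C}
    [IsSemiperfectRing (End X)] {ι κ : Type} [Fintype ι] [Fintype κ] [DecidableEq ι] [DecidableEq κ] {Xs : ι → C} {Ys : κ → C}
    (i₁ : X ≅ ⨁ Xs) (i₂ : X ≅ ⨁ Ys) (h₁ : ∀ j, Indecomposable (Xs j)) (h₂ : ∀ k, Indecomposable (Ys k)) (V : C) :
    Nat.card {j // Nonempty (Xs j ≅ V)} = Nat.card {k // Nonempty (Ys k ≅ V)} := by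
  obtain ⟨σ, hσ⟩ := exists_equiv_iso_of_iso_biproduct_of_indecomposable i₁ i₂ h₁ h₂
  exact natCard_nonempty_iso_eq_of_equiv σ hσ V

/-- **Two objects with semiperfect endomorphism rings are isomorphic iff their decompositions into indecomposables have the same
multiplicities** (⟹ by uniqueness; ⟸ by the class-count combinatorics g36-#8 `exists_equiv_forall_rel`: equal counts give a matching
`Xⱼ ≅ Y_{τ j}`, hence `⨁ Xⱼ ≅ ⨁ Yₖ`). [cite: Krause2015KS, Thm. 4.2, Cor. 4.4] [cite: Lam2001FirstCourse, §19 Thm. (19.21), Cor. (19.22)] -/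
theorem nonempty_iso_iff_forall_natCard_eq [HasBinaryBiproducts C] [IsIdempotentComplete C] {X Y : C} [IsSemiperfectRing (End X)]
    [IsSemiperfectRing (End Y)] {ι κ : Type} [Fintype ι] [Fintype κ] [DecidableEq ι] [DecidableEq κ] {Xs : ι → C} {Ys : κ → C}
    (i₁ : X ≅ ⨁ Xs) (i₂ : Y ≅ ⨁ Ys) (h₁ : ∀ j, Indecomposable (Xs j)) (h₂ : ∀ k, Indecomposable (Ys k)) :
    Nonempty (X ≅ Y) ↔ ∀ V : C, Nat.card {j // Nonempty (Xs j ≅ V)} = Nat.card {k // Nonempty (Ys k ≅ V)} := by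
  constructor
  · rintro ⟨φ⟩ V
    exact natCard_nonempty_iso_eq_of_iso_biproduct_of_indecomposable i₁ (φ ≪≫ i₂) h₁ h₂ V
  · intro h
    have hr : ∀ j, ∃ k, Nonempty (Xs j ≅ Ys k) := fun j => by
      have hpos : 0 < Nat.card {k // Nonempty (Ys k ≅ Xs j)} := by
        rw [← h (Xs j)]
        exact Nat.card_pos_iff.2 ⟨⟨⟨j, ⟨Iso.refl _⟩⟩⟩, inferInstance⟩
      obtain ⟨⟨k, ⟨e⟩⟩⟩ := (Nat.card_pos_iff.1 hpos).1
      exact ⟨k, ⟨e.symm⟩⟩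
    obtain ⟨τ, hτ⟩ := exists_equiv_forall_rel (fun j k => Nonempty (Xs j ≅ Ys k)) (fun k k' => Nonempty (Ys k ≅ Ys k'))
      ⟨fun _ => ⟨Iso.refl _⟩, fun ⟨f⟩ => ⟨f.symm⟩, fun ⟨f⟩ ⟨g⟩ => ⟨f ≪≫ g⟩⟩
      (fun _ _ _ ⟨f⟩ => ⟨fun ⟨g⟩ => ⟨f.symm ≪≫ g⟩, fun ⟨g⟩ => ⟨f ≪≫ g⟩⟩) (fun k₀ => h (Ys k₀)) hr
    exact ⟨i₁ ≪≫ biproduct.whiskerEquiv τ (fun j => (hτ j).some.symm) ≪≫ i₂.symm⟩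

end Multiplicity

/-! ## §2 Flattening powers of a decomposed object -/

section Flatten

/-- `X ≅ ⨁ⱼ Xⱼ` gives `⨁_{a ∈ α} X ≅ ⨁_{(a, j)} Xⱼ` over the sigma type (Mathlib's `biproductBiproductIso`). [cite: Krause2015KS, Thm. 4.2] -/
theorem nonempty_iso_biproduct_sigma_of_iso_biproduct {α : Type} [Finite α] {X : C} {ι : Type} [Finite ι] {Xs : ι → C}
    (e : X ≅ ⨁ Xs) : Nonempty ((⨁ fun _ : α => X) ≅ ⨁ fun p : (Σ _ : α, ι) => Xs p.2) :=
  ⟨biproduct.mapIso (fun _ => e) ≪≫ biproductBiproductIso (fun _ : α => ι) (fun _ j => Xs j)⟩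

end Flatten

/-! ## §3 Power cancellation -/

section PowerCancellation

variable [HasBinaryBiproducts C] [IsIdempotentComplete C]

/-- **POWER CANCELLATION: `⨁_{a ∈ α} X ≅ ⨁_{a ∈ α} Y` (`α` finite, non-empty) with `End X`, `End Y` semiperfect ⟹ `X ≅ Y`.**  Proof:
decompose `X ≅ ⨁ⱼ Xⱼ`, `Y ≅ ⨁ₖ Yₖ` into indecomposables with local endomorphism rings (g37-#2); the flattened decompositions of the common
power are matched by Krause's Thm. 4.2, `σ : α × ι ≃ α × κ` preserving isomorphism classes; cancelling `|α|` in the class counts (g36-#8)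
gives a class-preserving `τ : ι ≃ κ`, i.e. `⨁ Xⱼ ≅ ⨁ Yₖ`. [cite: Krause2015KS, Thm. 4.2, Cor. 4.4] [cite: Lam2001FirstCourse, §19 (19.21),
§20 Thm. (20.13)] -/
theorem nonempty_iso_of_biproduct_const_iso {α : Type} [Finite α] [Nonempty α] {X Y : C} [IsSemiperfectRing (End X)]
    [IsSemiperfectRing (End Y)] (φ : (⨁ fun _ : α => X) ≅ (⨁ fun _ : α => Y)) : Nonempty (X ≅ Y) := by
  classical
  haveI : Fintype α := Fintype.ofFinite α
  obtain ⟨n, Xs, ⟨eX⟩, hX⟩ := exists_iso_biproduct_indecomposable_of_isSemiperfectRing X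
  obtain ⟨m, Ys, ⟨eY⟩, hY⟩ := exists_iso_biproduct_indecomposable_of_isSemiperfectRing Y
  obtain ⟨i₁⟩ := nonempty_iso_biproduct_sigma_of_iso_biproduct (α := α) eX
  obtain ⟨i₂⟩ := nonempty_iso_biproduct_sigma_of_iso_biproduct (α := α) eY
  -- Krause 4.2 for the two flattened decompositions of `⨁_α X`
  obtain ⟨σ, hσ⟩ := exists_equiv_iso_of_iso_biproduct i₁ (φ ≪≫ i₂) (fun p => (hX p.2).2) (fun q => (hY q.2).2)
  -- cancel `|α|` in the class counts
  have hcount : ∀ V : C, Nat.card {j // Nonempty (Xs j ≅ V)} = Nat.card {k // Nonempty (Ys k ≅ V)} := fun V =>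
    natCard_subtype_eq_of_prod_equiv ((Equiv.sigmaEquivProd α (Fin n)).symm.trans (σ.trans (Equiv.sigmaEquivProd α (Fin m))))
      fun p => by
        obtain ⟨f⟩ := hσ ⟨p.1, p.2⟩
        show Nonempty (Xs p.2 ≅ V) ↔ Nonempty (Ys (σ ⟨p.1, p.2⟩).2 ≅ V)
        exact ⟨fun ⟨g⟩ => ⟨f.symm ≪≫ g⟩, fun ⟨g⟩ => ⟨f ≪≫ g⟩⟩
  obtain ⟨a₀⟩ := ‹Nonempty α›
  obtain ⟨τ, hτ⟩ := exists_equiv_forall_rel (fun j k => Nonempty (Xs j ≅ Ys k)) (fun k k' => Nonempty (Ys k ≅ Ys k'))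
    ⟨fun _ => ⟨Iso.refl _⟩, fun ⟨f⟩ => ⟨f.symm⟩, fun ⟨f⟩ ⟨g⟩ => ⟨f ≪≫ g⟩⟩
    (fun _ _ _ ⟨f⟩ => ⟨fun ⟨g⟩ => ⟨f.symm ≪≫ g⟩, fun ⟨g⟩ => ⟨f ≪≫ g⟩⟩) (fun k₀ => hcount (Ys k₀))
    (fun j => ⟨(σ ⟨a₀, j⟩).2, hσ ⟨a₀, j⟩⟩)
  exact ⟨eX ≪≫ biproduct.whiskerEquiv τ (fun j => (hτ j).some.symm) ≪≫ eY.symm⟩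

/-- **`X^{⊕t} ≅ Y^{⊕t}`, `t ≠ 0`, with `End X`, `End Y` semiperfect ⟹ `X ≅ Y`.** [cite: Krause2015KS, Thm. 4.2, Cor. 4.4]
[cite: Lam2001FirstCourse, §20 Thm. (20.13)] -/
theorem nonempty_iso_of_biproduct_fin_const_iso {t : ℕ} [NeZero t] {X Y : C} [IsSemiperfectRing (End X)] [IsSemiperfectRing (End Y)]
    (φ : (⨁ fun _ : Fin t => X) ≅ (⨁ fun _ : Fin t => Y)) : Nonempty (X ≅ Y) :=
  nonempty_iso_of_biproduct_const_iso φ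

/-- Power cancellation for objects with left ARTINIAN endomorphism rings. [cite: Krause2015KS, Thm. 4.2] [cite: Lam2001FirstCourse, §19 (19.21), §23] -/
theorem nonempty_iso_of_biproduct_const_iso_of_isArtinianRing {α : Type} [Finite α] [Nonempty α] {X Y : C} [IsArtinianRing (End X)]
    [IsArtinianRing (End Y)] (φ : (⨁ fun _ : α => X) ≅ (⨁ fun _ : α => Y)) : Nonempty (X ≅ Y) :=
  haveI := Literature.RingTheory.Idempotents.isSemiperfectRing_of_isArtinianRing (R := End X)
  haveI := Literature.RingTheory.Idempotents.isSemiperfectRing_of_isArtinianRing (R := End Y)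
  nonempty_iso_of_biproduct_const_iso φ

/-- Power cancellation in a `Hom`-finite `k`-linear category: `End X`, `End Y` finite-dimensional over a field. [cite: Krause2015KS, Thm. 4.2]
[cite: Lam2001FirstCourse, §19 (19.21), §20 Cor. (20.12)] -/
theorem nonempty_iso_of_biproduct_const_iso_of_finite (k : Type*) [Field k] [Linear k C] {α : Type} [Finite α] [Nonempty α] {X Y : C}
    [Module.Finite k (End X)] [Module.Finite k (End Y)] (φ : (⨁ fun _ : α => X) ≅ (⨁ fun _ : α => Y)) : Nonempty (X ≅ Y) :=
  haveI : IsArtinianRing (End X) := IsArtinianRing.of_finite k (End X)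
  haveI : IsArtinianRing (End Y) := IsArtinianRing.of_finite k (End Y)
  nonempty_iso_of_biproduct_const_iso_of_isArtinianRing φ

end PowerCancellation

end Literature.CategoryTheory.KrullSchmidt
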